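import Mathlib

/-!
# The recessive Riccati–Crum chain in a straightening variable

Let `x ↦ y(x)` be a `C¹` change of variable with `y′ = 1 − ε` and `y ≠ 0` (for the Regge–Wheeler family
on Schwarzschild, `y = r/√(1 − 2M/r)` makes the potential EXACTLY `c(c+1)/y² + b` with a small `b`,
and `ε = 2M/r + O(M²/r²)`).  For Riccati variables `W_k` of a Crum chain
(`W_k′ = U_k − W_k²`, `U_{k+1} = 2W_k² − U_k`) introduce the normalised unknowns
`η_k := −y·W_k − c_k` (`c_k` the recessive index, `c_{k+1} = c_k − 1`).  Then, with `′ = d/dx`: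

* `hasDerivAt_eta_seed`: if `U = c(c+1)/y² + b` then
  `y η′ = (2c+1) η + η² − ε (c + η) − b y²` (the seed Riccati equation);
* `hasDerivAt_eta_add`: for consecutive rungs (`c` and `c − 1`)
  `y (η₁ + η₂)′ = (2c − 1 + η₁ + η₂)(η₂ − η₁ − ε)` — an exact, derivative-free-in-`U` relation in
  which the potential no longer appears and the whole geometry enters through the single function `ε`;
* `crum_residual_eq_eta`: at the last rung (`c = 1`, `W = −(1+η)/y`) the residual potential is
  `2W² − U = (η + η² + y η′ + ε(1 + η))/y²`;
* `crum_residual_shift`: on the SHIFT FAMILY `η = a/(y − a)` (the exact chain of the flat case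
  `ε = 0`) the residual equals `ε/(y − a)²` — nonnegative wherever `ε ≥ 0`.

These are the normal form behind the far-side analysis of the peeled Regge–Wheeler potential
(route PhotonSphereChannels, stub R): the flat chain is the fixed shift family, and `ε > 0` is the only
source. [folklore]
-/

noncomputable section

namespace Literature.Analysis.ODE

open Set

/-- **Seed equation.** If `W′ = U − W²` at `x` with `U x = c(c+1)/y² + b`, `y′ = 1 − ε`, `y x ≠ 0`,
then `η := −y W − c` satisfies `η′ = ((2c+1)η + η² − ε(c+η) − b·y²)/y` at `x`. [folklore] -/
theorem hasDerivAt_eta_seed {W U y : ℝ → ℝ} {c b ε x : ℝ}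
    (hW : HasDerivAt W (U x - W x ^ 2) x) (hy : HasDerivAt y (1 - ε) x) (hy0 : y x ≠ 0)
    (hU : U x = c * (c + 1) / y x ^ 2 + b) :
    HasDerivAt (fun t => -y t * W t - c)
      (((2 * c + 1) * (-y x * W x - c) + (-y x * W x - c) ^ 2 - ε * (c + (-y x * W x - c))
        - b * y x ^ 2) / y x) x := by
  have h : HasDerivAt (fun t => -y t * W t - c) (-(1 - ε) * W x + -y x * (U x - W x ^ 2)) x :=
    (hy.fun_neg.fun_mul hW).sub_const c
  refine h.congr_deriv ?_
  rw [hU]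
  field_simp
  ring

/-- **Rung relation.** If `W₁′ = U₁ − W₁²`, `W₂′ = U₂ − W₂²`, `U₂ = 2W₁² − U₁` at `x`, `y′ = 1 − ε`,
`y x ≠ 0`, then for `η₁ := −yW₁ − c`, `η₂ := −yW₂ − (c − 1)`:
`(η₁ + η₂)′ = (2c − 1 + η₁ + η₂)(η₂ − η₁ − ε)/y` at `x`. [folklore] -/
theorem hasDerivAt_eta_add {W₁ W₂ U₁ U₂ y : ℝ → ℝ} {c ε x : ℝ}
    (h₁ : HasDerivAt W₁ (U₁ x - W₁ x ^ 2) x) (h₂ : HasDerivAt W₂ (U₂ x - W₂ x ^ 2) x)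
    (hU : U₂ x = 2 * W₁ x ^ 2 - U₁ x) (hy : HasDerivAt y (1 - ε) x) (hy0 : y x ≠ 0) :
    HasDerivAt (fun t => (-y t * W₁ t - c) + (-y t * W₂ t - (c - 1)))
      ((2 * c - 1 + (-y x * W₁ x - c) + (-y x * W₂ x - (c - 1)))
        * ((-y x * W₂ x - (c - 1)) - (-y x * W₁ x - c) - ε) / y x) x := by
  have h : HasDerivAt (fun t => (-y t * W₁ t - c) + (-y t * W₂ t - (c - 1)))
      ((-(1 - ε) * W₁ x + -y x * (U₁ x - W₁ x ^ 2))
        + (-(1 - ε) * W₂ x + -y x * (U₂ x - W₂ x ^ 2))) x :=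
    ((hy.fun_neg.fun_mul h₁).sub_const c).fun_add ((hy.fun_neg.fun_mul h₂).sub_const (c - 1))
  refine h.congr_deriv ?_
  rw [hU]
  field_simp
  ring

/-- The same rung relation stated for functions `η₁ η₂` given pointwise by `ηᵢ = −y Wᵢ − cᵢ`.
[folklore] -/
theorem hasDerivAt_eta_add' {W₁ W₂ U₁ U₂ y η₁ η₂ : ℝ → ℝ} {c ε x : ℝ}
    (h₁ : HasDerivAt W₁ (U₁ x - W₁ x ^ 2) x) (h₂ : HasDerivAt W₂ (U₂ x - W₂ x ^ 2) x)
    (hU : U₂ x = 2 * W₁ x ^ 2 - U₁ x) (hy : HasDerivAt y (1 - ε) x) (hy0 : y x ≠ 0)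
    (hη₁ : ∀ t, η₁ t = -y t * W₁ t - c) (hη₂ : ∀ t, η₂ t = -y t * W₂ t - (c - 1)) :
    HasDerivAt (fun t => η₁ t + η₂ t)
      ((2 * c - 1 + η₁ x + η₂ x) * (η₂ x - η₁ x - ε) / y x) x := by
  have h := hasDerivAt_eta_add (c := c) h₁ h₂ hU hy hy0
  have hf : (fun t => η₁ t + η₂ t) = fun t => (-y t * W₁ t - c) + (-y t * W₂ t - (c - 1)) := by
    funext t; rw [hη₁, hη₂]
  rw [hf, hη₁, hη₂]
  exact h

/-- **Terminal identity in `η`-form.** If `W′ = U − W²` at `x`, `W x = −(1 + η x)/y x`, `η` has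
derivative `η′` and `y′ = 1 − ε` at `x`, `y x ≠ 0`, then the Crum residual is
`2W² − U = (η + η² + y η′ + ε(1 + η))/y²` at `x`. [folklore] -/
theorem crum_residual_eq_eta {W U y η : ℝ → ℝ} {η' ε x : ℝ}
    (hW : HasDerivAt W (U x - W x ^ 2) x) (hWη : ∀ t, W t = -(1 + η t) / y t)
    (hη : HasDerivAt η η' x) (hy : HasDerivAt y (1 - ε) x) (hy0 : y x ≠ 0) :
    2 * W x ^ 2 - U x = (η x + η x ^ 2 + y x * η' + ε * (1 + η x)) / y x ^ 2 := by
  -- W′ computed from η′ and y′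
  have hf : W = fun t => -((1 + η t) / y t) := by
    funext t; rw [hWη]; ring
  have hW' : HasDerivAt W (-((η' * y x - (1 + η x) * (1 - ε)) / y x ^ 2)) x := by
    rw [hf]
    exact ((hη.const_add 1).fun_div hy hy0).fun_neg
  have huniq := hW.unique hW'
  have hWx := hWη x
  have hUx : U x = W x ^ 2 + -((η' * y x - (1 + η x) * (1 - ε)) / y x ^ 2) := by linarith
  rw [hUx, hWx]
  field_simp
  ring

/-- **Residual on the shift family.** For `η = a/(y − a)` (with `y x ≠ a`), the residual of
`crum_residual_eq_eta` is exactly `ε/(y − a)²`: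
`η + η² + y·η′ + ε(1 + η) = ε y²/(y − a)²` where `η′ = −a(1 − ε)/(y − a)²` is the derivative of
`t ↦ a/(y t − a)`. In particular the flat chain (`ε = 0`) has residual `0`, and the residual is
nonnegative wherever `ε ≥ 0`. [folklore] -/
theorem crum_residual_shift {y : ℝ → ℝ} {a ε x : ℝ} (hy : HasDerivAt y (1 - ε) x)
    (hya : y x ≠ a) :
    HasDerivAt (fun t => a / (y t - a)) (-(a * (1 - ε)) / (y x - a) ^ 2) x ∧
    (a / (y x - a) + (a / (y x - a)) ^ 2 + y x * (-(a * (1 - ε)) / (y x - a) ^ 2)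
        + ε * (1 + a / (y x - a))) = ε * y x ^ 2 / (y x - a) ^ 2 := by
  have hsub : y x - a ≠ 0 := sub_ne_zero.2 hya
  refine ⟨?_, ?_⟩
  · have h := (hasDerivAt_const x a).fun_div (hy.sub_const a) hsub
    refine h.congr_deriv ?_
    ring
  · field_simp
    ring

/-- Combining the two previous facts: for the last Riccati variable of the shift family,
`W = −(1 + a/(y − a))/y = −1/(y − a)`, the residual potential is `2W² − U = ε/(y − a)²`.
[folklore] -/
theorem crum_residual_shift_eq {W U y : ℝ → ℝ} {a ε x : ℝ}
    (hW : HasDerivAt W (U x - W x ^ 2) x) (hWy : ∀ t, W t = -(1 + a / (y t - a)) / y t)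
    (hy : HasDerivAt y (1 - ε) x) (hy0 : y x ≠ 0) (hya : y x ≠ a) :
    2 * W x ^ 2 - U x = ε / (y x - a) ^ 2 := by
  obtain ⟨hη, hres⟩ := crum_residual_shift (a := a) hy hya
  rw [crum_residual_eq_eta hW hWy hη hy hy0, hres]
  have hsub : y x - a ≠ 0 := sub_ne_zero.2 hya
  field_simp

end Literature.Analysis.ODE
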